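import Literature.NumberTheory.EllipticCurves.Rank1Residual.X9NoEntry
import Literature.NumberTheory.EllipticCurves.BSDSelmerPConverseUnipotentProofs
import HarnessLib

/-!
# `irr(p) ∧ ram(p) ⟹ ρ_{E,p^∞}` onto `GL₂(ℤ_p)` — at EVERY prime `p`, in particular `p = 3`:
# the "3-adic defect" stub of crux 19899 `ShimuraKolyvaginOrderBoundAtThreeSurj` is vacuous at
# every (ram) pair

Cell `bsd-stepL` (run/shared/lean/pub/bsd-stepL/), seat `bsd-stepL-shim-p2` (gen 3). The D7-restated
shared crux `ShimuraKolyvaginOrderBoundAtThreeSurj` (item stmt-BirchSwinnertonDyer-19899 of routes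
`route-BirchSwinnertonDyer-ClassRecordThree` = K2@3 and `route-BirchSwinnertonDyer-KolyvaginRoadThree`
= KOLY) has a registered BC3 skeleton (planner `bsd-stepL-plan` g27, `plan/D7/skel/Lines-birth-19899-v1.lean`)
split by the 3-ADIC IMAGE: stub A `stub_orderBoundSurj_adicOntoAtThree` under
`(∀ n : ℕ, W.HasSurjectiveModNGaloisRep (3 ^ n : ℕ))` (the printed `GL₂(ℤ₃)`-image regime of
Kolyvagin 1990 / Gross 1991 / McCallum 1991) and stub B `stub_orderBoundSurj_adicDefectAtThree`
under its negation (the Elkies locus, arXiv:math/0612734: `ρ̄_{E,3}` onto but `ρ̄_{E,9}` not onto —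
possible because Serre's lifting lemma IV-23 fails at `3`).

THIS FILE: both routes' `closes` consume the crux only at X11b pairs carrying a (ram) witness
(seat shim3b, `…ShimuraKolyvaginOrderBoundAtThreeSurjSuffices{,Closes}`: the consumer
`missingUpperBoundAt_of_ram_of_not_alpha_of_shape_pub_odd` holds `hram : Ram W p`, and
`Rank1Residual.surj_of_irr_of_ram` already turned that into `Surj W 3`, which is how D7 dropped the
`¬Surj` half). The SAME witness gives much more, by theorems ALREADY in the tree: a multiplicative
prime `ℓ ≠ p` with `p ∤ v_ℓ(Δ_min)` supplies `σ ∈ Γ_ℚ` acting on `E[p^n]` unipotently,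
`(σ - 1)² = 0`, and non-trivially on `E[p]` (Tate curve:
`WeierstrassCurve.exists_inertia_smul_ne_of_hasMultiplicativeReductionAtPrime` +
`WeierstrassCurve.exists_unipotent_of_hasMultiplicativeReductionAt`, any level `n ≥ 1`), and
`hasSurjectiveModNGaloisRep_pow_of_unipotent` (the transvection form of Serre's lifting lemma,
`TransvectionLifting.generalLinearGroup_eq_top_of_unipotent_mem`, valid for EVERY `p`) lifts
`ρ̄_{E,p}` onto to `ρ̄_{E,p^n}` onto. Hence:

* `exists_unipotent_pow_of_ram` — (ram) ⟹ the unipotent element on `E[p^n]`, every `n ≥ 1`;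
* `hasSurjectiveModNGaloisRep_pow_of_surj_of_ram` — `surj(p) ∧ ram(p) ⟹ ρ̄_{E,p^n}` onto, all `n`;
* `hasSurjectiveModNGaloisRep_pow_of_irr_of_ram` — `irr(p) ∧ ram(p) ⟹` the same;
* `adicOntoAtThree_of_surj_of_ram` / `not_adicDefectAtThree_of_surj_of_ram` — the `p = 3` instances
  in the binder shape of the 19899 skeleton: at a (ram) pair stub A's extra hypothesis HOLDS and
  stub B's extra hypothesis is FALSE.

CONSEQUENCE (planner's call, recorded here as kernel evidence, not acted on): on the consumer locus
of both routes the Elkies locus is EMPTY, so stub B is idle exactly as the `¬Surj ∧ Irr` stub of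
19616 was (D7); the crux may be cut to ONE load-bearing stub (seat shim3b g2's recommendation from
the print side, SHIM3B-G2-NOTE §1), and any proof of the residual may assume the full 3-adic image
`GL₂(ℤ₃)` — McCallum's / Kolyvagin's textbook Čebotarev setting — for free at every consumed pair.
Independent finite check of the group theory behind Elkies' phenomenon (not used by the kernel):
among the 324 classes of subgroups of `GL₂(ℤ/9)` exactly one proper class has full image in
`GL₂(𝔽₃)` and full determinant — index 27, order 144 — and it contains NO element of order 9
(kit job j260563, GAP), consistent with the transvection lifting used here.

HONEST FRAMING: theorems only (0 defs, no new facts), unconditional; nothing booked; the residual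
itself (Kolyvagin's order bound on `X_{N⁺,N⁻}` at `3 ∣ N⁺`) is untouched and OPEN; BSD is proved for
no curve here. References: [Serre1972] §1.12, App. A.1 (Tate curve inertia), §2.4 Prop. 15;
[SerreAbelianLadic1968] IV §3.4 Lemma 3; [SilvermanATAEC1994] V.4–V.5, Ex. 5.13(b);
N. Elkies, arXiv:math/0612734.
-/

noncomputable section

open scoped Classical NumberField NNReal

set_option linter.dupNamespace false

open WeierstrassCurve Field NumberField IsDedekindDomain
  Literature.NumberTheory.EllipticCurves Literature.NumberTheory.EllipticCurves.Rank1Residual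

namespace Summit.BirchSwinnertonDyer.BirchSwinnertonDyer.Theorems.ShimuraKolyvaginAdicImage

variable (W : WeierstrassCurve ℚ) [W.IsElliptic] (p : ℕ) [Fact p.Prime]

/-! ### §1. (ram) ⟹ a unipotent element of `Γ_ℚ` on `E[p^n]`, non-trivial on `E[p]`, every `n ≥ 1` -/

/-- **(ram) ⟹ a transvection on `E[p^n]`.** If `W/ℚ` (globally minimal model) has a prime `ℓ ≠ p`
of multiplicative reduction with `p ∤ v_ℓ(Δ_min)` (`Rank1Residual.Ram W p`), then for every `n ≥ 1`
some `σ ∈ Γ_ℚ` acts on `E[p^n]` with `(σ - 1)² = 0` and moves some `Q ∈ E[p^n]` with `p Q = O`: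
inertia at `ℓ` moves a `p`-torsion point of the Tate curve
(`exists_inertia_smul_ne_of_hasMultiplicativeReductionAtPrime`) and acts unipotently at every level
(`exists_unipotent_of_hasMultiplicativeReductionAt`). The `n = 1` case is the engine of
`Rank1Residual.surj_of_irr_of_ram`; the bookkeeping (place `v` of `𝓞 ℚ` above `ℓ`, spectral
valuation, local prime) is copied from there. [cite: SilvermanATAEC1994, V.4–V.5 and Exercise 5.13(b)]
[cite: Serre1972, §1.12 and Appendix A.1] -/
theorem exists_unipotent_pow_of_ram [W.IsGloballyMinimal] (hram : Ram W p) {n : ℕ} (hn : 1 ≤ n) :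
    ∃ σ : absoluteGaloisGroup ℚ,
      (∀ P : geomTorsion W ((p ^ n : ℕ) : ℤ), σ • (σ • P - P) = σ • P - P) ∧
        ∃ Q : geomTorsion W ((p ^ n : ℕ) : ℤ), p • Q = 0 ∧ σ • Q ≠ Q := by
  have hp : p.Prime := Fact.out
  obtain ⟨ℓ, hℓ, hℓp, hmult, hdiv⟩ := hram
  set v : HeightOneSpectrum (𝓞 ℚ) :=
    (Rat.HeightOneSpectrum.primesEquiv (R := 𝓞 ℚ)).symm ⟨ℓ, hℓ.out⟩ with hvdef
  have hv : Rat.HeightOneSpectrum.primesEquiv v = ⟨ℓ, hℓ.out⟩ := Equiv.apply_symm_apply _ _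
  have hvℓ : (Rat.HeightOneSpectrum.primesEquiv v : ℕ) = ℓ := congrArg Subtype.val hv
  obtain ⟨w, hw⟩ := v.exists_spectralValuation
  obtain ⟨𝔐, h𝔐⟩ := v.localPrimesAbove_nonempty
  have hmult_v : haveI := Fact.mk (Rat.HeightOneSpectrum.primesEquiv v).2;
      W.HasMultiplicativeReductionAtPrime (Rat.HeightOneSpectrum.primesEquiv v) := by
    have key : ∀ (q : ℕ) (hq : Fact q.Prime), q = ℓ →
        @WeierstrassCurve.HasMultiplicativeReductionAtPrime W q hq := by
      rintro q hq rfl; exact hmult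
    exact key _ _ hvℓ
  have hram_v : ¬ p ∣ padicValNat (Rat.HeightOneSpectrum.primesEquiv v)
      W.minimalDiscriminantInt.natAbs := by
    rw [hvℓ]; exact hdiv
  have hℓp' : (Rat.HeightOneSpectrum.primesEquiv v : ℕ) ≠ p := by rw [hvℓ]; exact hℓp
  have hloc := W.exists_inertia_smul_ne_of_hasMultiplicativeReductionAtPrime v hp hℓp' hmult_v
    hram_v hw h𝔐
  have hmultAt : W.HasMultiplicativeReductionAt v :=
    (WeierstrassCurve.hasMultiplicativeReductionAtPrime_iff_hasMultiplicativeReductionAt_ringOfIntegers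
      W v).mp hmult_v
  have hpv : (p : 𝓞 ℚ) ∉ v.asIdeal := by
    intro hmem
    have hv' := (natCast_mem_asIdeal_iff_eq_primesEquiv_symm v hp).mp hmem
    apply hℓp'
    rw [hv', Equiv.apply_symm_apply]
  exact W.exists_unipotent_of_hasMultiplicativeReductionAt hmultAt hp hpv hn hw h𝔐 hloc

/-! ### §2. `surj(p) ∧ ram(p) ⟹ ρ̄_{E,p^n}` onto for all `n` (every prime `p`) -/

/-- **`surj(p) ∧ ram(p) ⟹ ρ̄_{E,p^n} : Γ_ℚ → Aut(E[p^n])` is onto for every `n`** (so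
`ρ_{E,p^∞}(Γ_ℚ) = GL₂(ℤ_p)`), for EVERY prime `p` — including `p = 3`, where `surj(3)` alone does not
suffice (Elkies). Proof: `n = 0` — `E[1] = O` and `Aut` of a trivial group is trivial; `n ≥ 1` —
the transvection of §1 and `hasSurjectiveModNGaloisRep_pow_of_unipotent` (Serre's lifting lemma in
transvection form, no hypothesis on `p`). [cite: SerreAbelianLadic1968, Ch. IV §3.4, Lemma 3]
[cite: Serre1972, §1.12 and Appendix A.1] -/
theorem hasSurjectiveModNGaloisRep_pow_of_surj_of_ram [W.IsGloballyMinimal] (hsurj : Surj W p)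
    (hram : Ram W p) (n : ℕ) : W.HasSurjectiveModNGaloisRep (p ^ n : ℕ) := by
  cases n with
  | zero =>
    haveI : Subsingleton (geomTorsion W ((p ^ 0 : ℕ) : ℤ)) := ⟨fun a b ↦ by
      have ha := AddSubgroup.torsionBy.nsmul_iff.mp a.2
      have hb := AddSubgroup.torsionBy.nsmul_iff.mp b.2
      simp only [pow_zero, one_smul] at ha hb
      exact Subtype.ext (ha.trans hb.symm)⟩
    intro y
    exact ⟨1, Multiplicative.toAdd.injective (AddEquiv.ext fun a ↦ Subsingleton.elim _ _)⟩
  | succ k =>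
    exact hasSurjectiveModNGaloisRep_pow_of_unipotent W p hsurj (k + 1)
      (exists_unipotent_pow_of_ram W p hram k.succ_pos)

/-- **`irr(p) ∧ ram(p) ⟹ ρ̄_{E,p^n}` onto for every `n`** (every prime `p`): `irr ∧ ram ⟹ surj`
(`Rank1Residual.surj_of_irr_of_ram`, Serre 1972 Prop. 15 + the Tate-curve transvection), then
`hasSurjectiveModNGaloisRep_pow_of_surj_of_ram`. On the BSD residual class X11b (`E[p]`
irreducible) this says: every pair with a (ram) witness has FULL `p`-adic image `GL₂(ℤ_p)`.
[cite: Serre1972, §2.4 Prop. 15] [cite: SerreAbelianLadic1968, Ch. IV §3.4, Lemma 3] -/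
theorem hasSurjectiveModNGaloisRep_pow_of_irr_of_ram [W.IsGloballyMinimal] (hirr : Irr W p)
    (hram : Ram W p) (n : ℕ) : W.HasSurjectiveModNGaloisRep (p ^ n : ℕ) :=
  hasSurjectiveModNGaloisRep_pow_of_surj_of_ram W p (surj_of_irr_of_ram W p hirr hram) hram n

/-! ### §3. At `p = 3`, in the binder shape of the 19899 skeleton -/

/-- **Stub A's hypothesis holds at every (ram) pair**: for `W/ℚ` globally minimal with `ρ̄_{E,3}`
onto and a multiplicative prime `ℓ ≠ 3` with `3 ∤ v_ℓ(Δ_min)`, `ρ̄_{E,3^n}` is onto for all `n`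
(the `GL₂(ℤ₃)`-image regime of `stub_orderBoundSurj_adicOntoAtThree`).
[cite: SerreAbelianLadic1968, Ch. IV §3.4, Lemma 3] -/
theorem adicOntoAtThree_of_surj_of_ram [W.IsGloballyMinimal] [Fact (Nat.Prime 3)]
    (hsurj : Surj W 3) (hram : Ram W 3) : ∀ n : ℕ, W.HasSurjectiveModNGaloisRep (3 ^ n : ℕ) :=
  hasSurjectiveModNGaloisRep_pow_of_surj_of_ram W 3 hsurj hram

/-- **Stub B's hypothesis fails at every (ram) pair**: under `Surj W 3` and `Ram W 3` the Elkies
locus `¬ (∀ n, ρ̄_{E,3^n} onto)` (the extra binder of `stub_orderBoundSurj_adicDefectAtThree`) is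
empty — so on the consumer locus of both routes' `closes` (X11b pairs with a (ram) witness) stub B
is idle. [cite: SerreAbelianLadic1968, Ch. IV §3.4, Lemma 3] -/
theorem not_adicDefectAtThree_of_surj_of_ram [W.IsGloballyMinimal] [Fact (Nat.Prime 3)]
    (hsurj : Surj W 3) (hram : Ram W 3) : ¬ ¬ (∀ n : ℕ, W.HasSurjectiveModNGaloisRep (3 ^ n : ℕ)) :=
  not_not_intro (adicOntoAtThree_of_surj_of_ram W hsurj hram)

/-- **`irr(3) ∧ ram(3)` version** (the class-X11b form: `E[3]` irreducible is a class axiom, (ram)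
the consumer's witness): full 3-adic image at every consumed pair. [cite: Serre1972, §2.4 Prop. 15] -/
theorem adicOntoAtThree_of_irr_of_ram [W.IsGloballyMinimal] [Fact (Nat.Prime 3)]
    (hirr : Irr W 3) (hram : Ram W 3) : ∀ n : ℕ, W.HasSurjectiveModNGaloisRep (3 ^ n : ℕ) :=
  hasSurjectiveModNGaloisRep_pow_of_irr_of_ram W 3 hirr hram

end Summit.BirchSwinnertonDyer.BirchSwinnertonDyer.Theorems.ShimuraKolyvaginAdicImage

end
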